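import Mathlib

/-!
# The Fejér–Riesz theorem, I: the conjugate-reciprocal polynomial and two lemmas of F. Riesz's proof

A trigonometric polynomial `T(θ) = Σ_{|k| ≤ n} c_k e^{ikθ}` which is real and nonnegative for every real `θ`
is the squared modulus `|Q(e^{iθ})|²` of an algebraic polynomial `Q` of degree `≤ n` [Fejér 1916, §1; the
root-pairing proof is F. Riesz's].  We state and prove it in POLYNOMIAL form, which is the form consumed
downstream (Boas–Kac factorisation of sums of autocorrelations): writing `p(z) = z^n T` (`p = Σ_{j ≤ 2n}
c_{j-n} X^j`, `natDegree p ≤ 2n`), the hypothesis reads `0 ≤ conj z ^ n * p.eval z` on the unit circle (in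
the `ComplexOrder`, i.e. real and nonnegative), and the conclusion is the IDENTITY OF POLYNOMIALS
`p = q * conjReverse n q`, where `conjReverse n q = Σ_{j ≤ n} conj (q_j) X^{n-j}` is the conjugate-reciprocal
polynomial (`(conjReverse n q)(z) = z^n · conj (q z)` on the circle).  Comparing coefficients, the coefficient
sequence of `p` is the autocorrelation sequence `d ↦ Σ_j q_{j} conj (q_{j-d})` of that of `q`; on the circle,
`conj z ^ n * p z = |q z|²`.

Proof (Riesz): induction on `n`.  By nonnegativity `p` is conjugate-reciprocal (`conjReverse (2n) p = p`), so
its roots are symmetric under `α ↦ 1/conj α`; if `p(0) = 0` the top coefficient vanishes too and we divide by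
`X`; otherwise pick a root `α ≠ 0` (FTA): when `|α| ≠ 1`, `1/conj α ≠ α` is a second root; when `|α| = 1`,
`θ ↦ conj z^n p(z)` (`z = e^{iθ}`) is a nonnegative real function vanishing at `arg α`, so its derivative
vanishes there and `α` is a double root.  Either way `p = (X - α)(X - 1/conj α) p₂`, and on the circle
`(z - α)(z - 1/conj α) = -(conj α)⁻¹ z |z - α|²`, so `p₁ := -(conj α)⁻¹ p₂` satisfies the hypothesis at level
`n - 1` (at the point `z = α` itself by continuity); induct and put `q := (X - α) q₁`.

THIS FILE: unit-circle bookkeeping, `conjReverse N q := reflect N (q.map conj)` (Mathlib's `reflect`) and its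
sum / evaluation / coefficient / multiplicativity lemmas,
conjugate-reciprocity of nonnegative `p`, the double-root lemma (a root on the circle of a nonnegative `p`
kills the derivative) and the continuity lemma (nonnegativity off one point of the circle extends to the
point).  The induction itself is `FejerRieszFactorization.lean`.  All polynomial identities are verified by
evaluation on the (infinite) unit circle.
-/

noncomputable section

open Polynomial Filter
open _root_.Complex
open scoped ComplexConjugate ComplexOrder Topology

namespace Literature.Analysis.Fourier.FejerRiesz

/-! ## Unit-circle bookkeeping -/

/-- On the unit circle `z * conj z = 1`. [folklore] -/
theorem mul_conj_of_norm_eq_one {z : ℂ} (hz : ‖z‖ = 1) : z * conj z = 1 := by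
  rw [mul_conj, normSq_eq_norm_sq, hz]; simp

/-- On the unit circle `conj z * z = 1`. [folklore] -/
theorem conj_mul_of_norm_eq_one {z : ℂ} (hz : ‖z‖ = 1) : conj z * z = 1 := by
  rw [mul_comm]; exact mul_conj_of_norm_eq_one hz

/-- A point of the unit circle is nonzero. [folklore] -/
theorem ne_zero_of_norm_eq_one {z : ℂ} (hz : ‖z‖ = 1) : z ≠ 0 := by
  rintro rfl; simp at hz

/-- On the unit circle `(conj z)⁻¹ = z`. [folklore] -/
theorem inv_conj_of_norm_eq_one {z : ℂ} (hz : ‖z‖ = 1) : (conj z)⁻¹ = z :=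
  inv_eq_of_mul_eq_one_left (mul_conj_of_norm_eq_one hz)

/-- Two complex polynomials that agree on the unit circle are equal (the circle is infinite). [folklore] -/
theorem eq_of_eval_eq_on_circle {p q : ℂ[X]} (h : ∀ z : ℂ, ‖z‖ = 1 → p.eval z = q.eval z) : p = q := by
  apply Polynomial.eq_of_infinite_eval_eq
  have hinf : (Metric.sphere (0 : ℂ) 1).Infinite := by
    refine (isPreconnected_sphere ?_ (0 : ℂ) 1).infinite_of_nontrivial
      ⟨1, by simp, -1, by simp, by norm_num⟩
    rw [Complex.rank_real_complex]; exact Cardinal.one_lt_two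
  exact hinf.mono fun z hz => h z (by simpa using hz)

/-! ## The conjugate-reciprocal polynomial -/

/-- The conjugate-reciprocal ("reversed and conjugated") polynomial at level `N`: Mathlib's `reflect N` of the
coefficientwise conjugate, `conjReverse N q = reflect N (q.map conj)`; for `natDegree q ≤ N` this is
`Σ_{j ≤ N} conj (q_j) · X^{N-j}` (`conjReverse_eq_sum`) and evaluates to `z^N · conj (q z)` on the unit circle.
[cite: Fejer1916, §1] -/
def conjReverse (N : ℕ) (q : ℂ[X]) : ℂ[X] :=
  reflect N (q.map (starRingEnd ℂ))

/-- Coefficients: `(conjReverse N q)_j = conj (q_{revAt N j})` (`Polynomial.coeff_reflect`). [folklore] -/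
theorem coeff_conjReverse' (N : ℕ) (q : ℂ[X]) (j : ℕ) : (conjReverse N q).coeff j = conj (q.coeff (revAt N j)) := by
  rw [conjReverse, coeff_reflect, coeff_map]

/-- Coefficients below the level: `(conjReverse N q)_j = conj (q_{N-j})` for `j ≤ N`. [folklore] -/
theorem coeff_conjReverse {N : ℕ} (q : ℂ[X]) {j : ℕ} (hj : j ≤ N) :
    (conjReverse N q).coeff j = conj (q.coeff (N - j)) := by
  rw [coeff_conjReverse', revAt_le hj]

/-- The explicit sum: `conjReverse N q = Σ_{j ≤ N} conj (q_j) X^{N-j}` when `natDegree q ≤ N`. [folklore] -/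
theorem conjReverse_eq_sum {N : ℕ} {q : ℂ[X]} (hq : q.natDegree ≤ N) :
    conjReverse N q = ∑ j ∈ Finset.range (N + 1), C (conj (q.coeff j)) * X ^ (N - j) := by
  ext i
  rw [coeff_conjReverse', finsetSum_coeff]
  by_cases hi : i ≤ N
  · rw [revAt_le hi, Finset.sum_eq_single (N - i)]
    · rw [coeff_C_mul_X_pow, if_pos (Nat.sub_sub_self hi).symm]
    · intro j hj hji
      rw [coeff_C_mul_X_pow, if_neg]
      intro h
      apply hji
      have hjN : j ≤ N := Nat.lt_succ_iff.mp (Finset.mem_range.mp hj)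
      omega
    · intro h
      exact absurd (Finset.mem_range.mpr (by omega)) h
  · have hi' : N < i := not_le.mp hi
    rw [revAt_eq_self_of_lt hi', coeff_eq_zero_of_natDegree_lt (hq.trans_lt hi'), map_zero]
    symm
    refine Finset.sum_eq_zero fun j _ => ?_
    rw [coeff_C_mul_X_pow, if_neg]
    omega

/-- `natDegree (conjReverse N q) ≤ N` when `natDegree q ≤ N` (`Polynomial.natDegree_reflect_le`). [folklore] -/
theorem natDegree_conjReverse_le {N : ℕ} {q : ℂ[X]} (hq : q.natDegree ≤ N) : (conjReverse N q).natDegree ≤ N :=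
  natDegree_reflect_le.trans (max_le le_rfl (natDegree_map_le.trans hq))

/-- Evaluation of the conjugate-reciprocal polynomial at a nonzero point:
`(conjReverse N q)(w) = w^N · conj (q ((conj w)⁻¹))` when `natDegree q ≤ N`. [folklore] -/
theorem eval_conjReverse {N : ℕ} {q : ℂ[X]} (hq : q.natDegree ≤ N) {w : ℂ} (hw : w ≠ 0) :
    (conjReverse N q).eval w = w ^ N * conj (q.eval (conj w)⁻¹) := by
  rw [conjReverse_eq_sum hq, eval_finsetSum, eval_eq_sum_range' (Nat.lt_succ_of_le hq), map_sum, Finset.mul_sum]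
  refine Finset.sum_congr rfl fun j hj => ?_
  have hjN : j ≤ N := Nat.lt_succ_iff.mp (Finset.mem_range.mp hj)
  rw [eval_mul, eval_C, eval_pow, eval_X, map_mul, map_pow, map_inv₀, Complex.conj_conj,
    pow_sub₀ _ hw hjN, inv_pow]
  ring

/-- On the unit circle `(conjReverse N q)(z) = z^N · conj (q z)` (`natDegree q ≤ N`). [folklore] -/
theorem eval_conjReverse_circle {N : ℕ} {q : ℂ[X]} (hq : q.natDegree ≤ N) {z : ℂ} (hz : ‖z‖ = 1) :
    (conjReverse N q).eval z = z ^ N * conj (q.eval z) := by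
  rw [eval_conjReverse hq (ne_zero_of_norm_eq_one hz), inv_conj_of_norm_eq_one hz]

/-- To prove `p = q * conjReverse N q` it suffices to check `p(z) = z^N · q(z) · conj (q z)` on the unit
circle. [folklore] -/
theorem eq_mul_conjReverse_of_eval {p q : ℂ[X]} {N : ℕ} (hq : q.natDegree ≤ N)
    (h : ∀ z : ℂ, ‖z‖ = 1 → p.eval z = z ^ N * (q.eval z * conj (q.eval z))) :
    p = q * conjReverse N q :=
  eq_of_eval_eq_on_circle fun z hz => by rw [eval_mul, eval_conjReverse_circle hq hz, h z hz]; ring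

/-- Raising the level: `conjReverse (N+1) q = X * conjReverse N q` when `natDegree q ≤ N`. [folklore] -/
theorem conjReverse_succ {N : ℕ} {q : ℂ[X]} (hq : q.natDegree ≤ N) :
    conjReverse (N + 1) q = X * conjReverse N q :=
  eq_of_eval_eq_on_circle fun z hz => by
    rw [eval_conjReverse_circle (show q.natDegree ≤ N + 1 from hq.trans N.le_succ) hz, eval_mul, eval_X,
      eval_conjReverse_circle hq hz]
    ring

/-- Multiplicativity: `conjReverse (M+N) (f * g) = conjReverse M f * conjReverse N g` for `natDegree f ≤ M`,
`natDegree g ≤ N` (`Polynomial.reflect_mul`). [folklore] -/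
theorem conjReverse_mul {M N : ℕ} {f g : ℂ[X]} (hf : f.natDegree ≤ M) (hg : g.natDegree ≤ N) :
    conjReverse (M + N) (f * g) = conjReverse M f * conjReverse N g := by
  unfold conjReverse
  rw [Polynomial.map_mul, reflect_mul _ _ (natDegree_map_le.trans hf) (natDegree_map_le.trans hg)]

/-- On the unit circle `conj z ^ N * (q * conjReverse N q)(z) = |q z|²`. [folklore] -/
theorem conj_pow_mul_eval_mul_conjReverse {N : ℕ} {q : ℂ[X]} (hq : q.natDegree ≤ N) {z : ℂ}
    (hz : ‖z‖ = 1) : conj z ^ N * (q * conjReverse N q).eval z = (normSq (q.eval z) : ℂ) := by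
  rw [eval_mul, eval_conjReverse_circle hq hz, ← mul_conj, ← mul_assoc, ← mul_assoc, mul_comm (conj z ^ N),
    mul_assoc (q.eval z), ← mul_pow, conj_mul_of_norm_eq_one hz, one_pow, mul_one]

/-! ## Conjugate-reciprocity of nonnegative `p` -/

/-- If `conj z ^ m * p z` is a nonnegative real on the unit circle and `natDegree p ≤ 2m`, then `p` is
conjugate-reciprocal: `conjReverse (2m) p = p`. [cite: Fejer1916, §1] -/
theorem conjReverse_eq_self_of_nonneg {p : ℂ[X]} {m : ℕ} (hdeg : p.natDegree ≤ 2 * m)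
    (hpos : ∀ z : ℂ, ‖z‖ = 1 → 0 ≤ conj z ^ m * p.eval z) : conjReverse (2 * m) p = p :=
  eq_of_eval_eq_on_circle fun z hz => by
    rw [eval_conjReverse_circle hdeg hz]
    have hreal : conj (conj z ^ m * p.eval z) = conj z ^ m * p.eval z :=
      conj_eq_iff_im.mpr ((Complex.nonneg_iff.mp (hpos z hz)).2.symm)
    rw [map_mul, map_pow, Complex.conj_conj] at hreal
    -- `z^m conj(p z) = conj z^m p z`; multiply by `z^m` and use `z conj z = 1`
    calc z ^ (2 * m) * conj (p.eval z) = z ^ m * (z ^ m * conj (p.eval z)) := by ring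
      _ = z ^ m * (conj z ^ m * p.eval z) := by rw [hreal]
      _ = (z * conj z) ^ m * p.eval z := by ring
      _ = p.eval z := by rw [mul_conj_of_norm_eq_one hz, one_pow, one_mul]

/-! ## A root on the circle of a nonnegative `p` is a double root -/

/-- If `conj z ^ n * p z ≥ 0` on the unit circle and `p(α) = 0` with `|α| = 1`, then `p'(α) = 0`: the real
function `θ ↦ conj z^n p(z)`, `z = e^{iθ}`, attains its minimum `0` at `θ = arg α`. [cite: Fejer1916, §1] -/
theorem eval_derivative_eq_zero_of_nonneg {p : ℂ[X]} {n : ℕ}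
    (hpos : ∀ z : ℂ, ‖z‖ = 1 → 0 ≤ conj z ^ n * p.eval z) {α : ℂ} (hα : ‖α‖ = 1) (hroot : p.eval α = 0) :
    (derivative p).eval α = 0 := by
  -- the curve `γ θ = e^{iθ}` and `ψ θ = e^{-inθ} p(e^{iθ}) = conj (γ θ)^n p(γ θ)`
  set θ₀ : ℝ := arg α with hθ₀
  have hγ₀ : cexp (θ₀ * I) = α := by
    have h := norm_mul_exp_arg_mul_I α
    rwa [hα, Complex.ofReal_one, one_mul] at h
  have hγ : ∀ θ : ℝ, HasDerivAt (fun t : ℝ => cexp (t * I)) (cexp (θ * I) * I) θ := fun θ =>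
    ((hasDerivAt_id θ).ofReal_comp.mul_const I |>.congr_deriv (by simp)).cexp
  have hψ₁ : ∀ θ : ℝ, HasDerivAt (fun t : ℝ => cexp (-(n : ℂ) * (t * I)))
      (cexp (-(n : ℂ) * (θ * I)) * (-(n : ℂ) * I)) θ := fun θ =>
    (((hasDerivAt_id θ).ofReal_comp.mul_const I |>.congr_deriv (by simp)).const_mul (-(n : ℂ))).cexp
  have hψ₂ : HasDerivAt (fun t : ℝ => p.eval (cexp (t * I)))
      ((derivative p).eval (cexp (θ₀ * I)) * (cexp (θ₀ * I) * I)) θ₀ :=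
    by
    have h := (Polynomial.hasDerivAt p (cexp (θ₀ * I))).comp θ₀ (hγ θ₀)
    exact h
  have hψ : HasDerivAt (fun t : ℝ => cexp (-(n : ℂ) * (t * I)) * p.eval (cexp (t * I)))
      (cexp (-(n : ℂ) * (θ₀ * I)) * (-(n : ℂ) * I) * p.eval (cexp (θ₀ * I)) +
        cexp (-(n : ℂ) * (θ₀ * I)) * ((derivative p).eval (cexp (θ₀ * I)) * (cexp (θ₀ * I) * I))) θ₀ :=
    (hψ₁ θ₀).mul hψ₂
  rw [hγ₀, hroot, mul_zero, zero_add] at hψ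
  set D : ℂ := cexp (-(n : ℂ) * (θ₀ * I)) * ((derivative p).eval α * (α * I)) with hD
  -- `ψ θ = conj z ^ n * p z` with `z = e^{iθ}` on the circle, hence a nonnegative real
  have hψval : ∀ t : ℝ, 0 ≤ cexp (-(n : ℂ) * (t * I)) * p.eval (cexp (t * I)) := by
    intro t
    have h1 : ‖cexp (t * I)‖ = 1 := norm_exp_ofReal_mul_I t
    have h2 : conj (cexp (t * I)) ^ n = cexp (-(n : ℂ) * (t * I)) := by
      rw [← exp_conj, ← Complex.exp_nat_mul, map_mul, conj_ofReal, conj_I]; ring_nf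
    simpa [h2] using hpos _ h1
  -- real part: local minimum at `θ₀` ⇒ derivative `0`
  have hre : HasDerivAt (fun t : ℝ => (cexp (-(n : ℂ) * (t * I)) * p.eval (cexp (t * I))).re) D.re θ₀ :=
    reCLM.hasFDerivAt.comp_hasDerivAt θ₀ hψ
  have hmin : IsLocalMin (fun t : ℝ => (cexp (-(n : ℂ) * (t * I)) * p.eval (cexp (t * I))).re) θ₀ := by
    refine Filter.Eventually.of_forall fun t => ?_
    have h0 : (cexp (-(n : ℂ) * (θ₀ * I)) * p.eval (cexp (θ₀ * I))).re = 0 := by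
      rw [hγ₀, hroot, mul_zero, Complex.zero_re]
    show (cexp (-(n : ℂ) * (θ₀ * I)) * p.eval (cexp (θ₀ * I))).re ≤
      (cexp (-(n : ℂ) * (t * I)) * p.eval (cexp (t * I))).re
    rw [h0]
    exact (Complex.nonneg_iff.mp (hψval t)).1
  have hDre : D.re = 0 := hmin.hasDerivAt_eq_zero hre
  -- imaginary part: identically zero ⇒ derivative `0`
  have him : HasDerivAt (fun t : ℝ => (cexp (-(n : ℂ) * (t * I)) * p.eval (cexp (t * I))).im) D.im θ₀ :=
    imCLM.hasFDerivAt.comp_hasDerivAt θ₀ hψ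
  have him0 : (fun t : ℝ => (cexp (-(n : ℂ) * (t * I)) * p.eval (cexp (t * I))).im) = fun _ => 0 := by
    funext t; exact (Complex.nonneg_iff.mp (hψval t)).2.symm
  rw [him0] at him
  have hDim : D.im = 0 := (him.unique (hasDerivAt_const θ₀ (0 : ℝ))).symm ▸ rfl
  have hD0 : D = 0 := Complex.ext (by simpa using hDre) (by simpa using hDim)
  -- cancel the nonzero factors
  have hα0 : α ≠ 0 := ne_zero_of_norm_eq_one hα
  have : cexp (-(n : ℂ) * (θ₀ * I)) * (α * I) * (derivative p).eval α = 0 := by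
    rw [← hD0, hD]; ring
  simpa [exp_ne_zero, hα0, I_ne_zero] using this

/-! ## Nonnegativity at one exceptional point of the circle by continuity -/

/-- A continuous function which is a nonnegative real on the unit circle minus one point is a nonnegative
real on the whole circle. [folklore] -/
theorem nonneg_on_circle_of_nonneg_off_point {g : ℂ → ℂ} (hg : Continuous g) (α : ℂ)
    (h : ∀ z : ℂ, ‖z‖ = 1 → z ≠ α → 0 ≤ g z) {z : ℂ} (hz : ‖z‖ = 1) : 0 ≤ g z := by
  by_cases hzα : z = α
  swap
  · exact h z hz hzα
  subst hzα
  -- approach `z` along the circle: `u k = z · exp (i/(k+1))`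
  set t : ℕ → ℝ := fun k => 1 / ((k : ℝ) + 1) with ht
  set u : ℕ → ℂ := fun k => z * cexp (t k * I) with hu
  have htpos : ∀ k, 0 < t k := fun k => by simp only [ht]; positivity
  have htle : ∀ k, t k ≤ 1 := fun k => by
    simp only [ht]
    rw [div_le_one (by positivity)]
    linarith [(Nat.cast_nonneg k : (0 : ℝ) ≤ k)]
  have hnorm : ∀ k, ‖u k‖ = 1 := fun k => by
    simp only [hu, norm_mul, norm_exp_ofReal_mul_I, hz, mul_one]
  have hne : ∀ k, u k ≠ z := by
    intro k hk
    have hz0 : z ≠ 0 := ne_zero_of_norm_eq_one hz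
    have h1 : cexp (t k * I) = 1 := by
      have : z * cexp (t k * I) = z * 1 := by rw [mul_one]; exact hk
      exact mul_left_cancel₀ hz0 this
    obtain ⟨m, hm⟩ := Complex.exp_eq_one_iff.mp h1
    have hm' : (t k : ℂ) = (2 * Real.pi * m : ℝ) := by
      have := congrArg (fun w => w * (-I)) hm
      simp only [mul_assoc, mul_neg, I_mul_I, neg_neg, mul_one] at this
      rw [this]; push_cast; ring
    have hm'' : t k = 2 * Real.pi * m := by exact_mod_cast hm'
    have hpi : 3 < Real.pi := Real.pi_gt_three
    rcases le_or_gt m 0 with hm0 | hm0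
    · have : (m : ℝ) ≤ 0 := by exact_mod_cast hm0
      nlinarith [htpos k]
    · have : (1 : ℝ) ≤ m := by exact_mod_cast hm0
      nlinarith [htle k]
  have hlim : Tendsto u atTop (𝓝 z) := by
    have h0 : Tendsto t atTop (𝓝 0) := tendsto_one_div_add_atTop_nhds_zero_nat
    have h1 : Tendsto (fun k => z * cexp (t k * I)) atTop (𝓝 (z * cexp ((0 : ℝ) * I))) :=
      ((continuous_const.mul ((continuous_ofReal.mul continuous_const).cexp)).tendsto (0 : ℝ)).comp h0
    simpa [hu] using h1
  exact ge_of_tendsto' ((hg.tendsto z).comp hlim) fun k => h (u k) (hnorm k) (hne k)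

/-- Division of a nonnegative complex number (a nonnegative real) by a positive real is nonnegative.
[folklore] -/
theorem nonneg_div_ofReal {w : ℂ} (hw : 0 ≤ w) {r : ℝ} (hr : 0 < r) : 0 ≤ w / (r : ℂ) := by
  obtain ⟨hre, him⟩ := Complex.nonneg_iff.mp hw
  refine Complex.nonneg_iff.mpr ⟨?_, ?_⟩
  · rw [div_ofReal_re]; positivity
  · rw [div_ofReal_im, ← him, zero_div]

end Literature.Analysis.Fourier.FejerRiesz

end
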